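import Literature.NumberTheory.Automorphic.Liu2021.AppendixA.AFLMinusculeCase
import HarnessLib

/-!
# Liu 2021, Appendix A — THEOREM-ONLY COMPANION of the statement carpet ★ `AFLMinusculeCase`: Theorem A.7 assembled

Proof file (theorems only: no definition, no named fact, no instance, no `sorry`), sibling of the statement-only carpet
★ `Literature/NumberTheory/Automorphic/Liu2021/AppendixA/AFLMinusculeCase.lean` [Liu2021, App. A, print pp. 90–95], in that
carpet's namespace.

**Theorem A.7** (p. 95 L28): «Conjecture 1.12 holds when `(ξ, x)` is minuscule.»  Printed proof (p. 95 L29–30): «This follows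
immediately from Proposition A.2, Lemma A.4, and Lemma A.6.»  The statement of A.7 is ★ `Sec13Data.Rem114` (typed with
Rem. 1.14 by the §1.3 carpet); this file PROVES the printed implication

  `PropA2 ∧ LemA4 ∧ LemA6 (+ the datum's field transferFactor_eq) ⟹ Rem114`

as `AFLData.rem114_of_propA2_lemA4_lemA6`, i.e. it certifies that the carpet's typed readings of A.2, A.4, A.6 compose, sign for
sign and factor for factor (`−ω · (−2 log q · ω · Σ) = 2 log q · Σ` with `ω² = 1`, then `Σ = χ` by cases on the unique odd
self-reciprocal factor `Q(T)`), into the typed 1.12.  Writing the assembly out surfaces the two steps the word «immediately»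
leaves silent, which enter as explicit, separately named hypotheses (no new named fact is minted; both are standing properties
of the ⟨CARRIER⟩ symbols `chiInt` ∕ `dlFixed` of ★ `Sec13Data` ∕ ★ `AFLCarriers`, not results of App. A):

* `hχ0` — if `𝒱(Λ)^{ξ̄}` is empty then `χ(𝒪_{Γ_ξ} ⊗^𝕃 𝒪_{Δ𝒵_n(x)}) = 0` (by Lem. A.5 `Γ_ξ ∩ Δ𝒵_n(x) ≅ 𝒱(Λ)^{ξ̄}` is then empty, and a
  derived tensor product of structure sheaves with empty support has Euler–Poincaré characteristic `0`); needed in the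
  «otherwise» case of Lem. A.4, where Lem. A.6 AS PRINTED says only that `𝒱(Λ)^{ξ̄}` is empty;
* `hne` — if `P(T)` HAS a unique self-reciprocal monic irreducible factor `Q(T)` with `m(Q(T))` odd then `𝒱(Λ)^{ξ̄}` is
  non-empty: the converse of the first sentence of Lem. A.6 («empty unless …»), which the cited [RTZ13, Prop. 8.1] ∕ [HLZ19,
  Lem. 5.1.1] state as an equivalence; needed because Lem. A.4 then gives `Σ = deg Q · (m(Q)+1)/2 · ∏ (1 + m(R)) ≠ 0` while
  Lem. A.6 AS PRINTED evaluates `χ` only under «Assume that `𝒱(Λ)^{ξ̄}` is non-empty».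

Nothing else is used (in particular not Lem. A.1, Lem. A.5, `tau_spec`, `isMinuscule_iff`).  Net debt 0; axioms TRIO.

HC_CM is proved only modulo the 7 printed citations (2 remaining: hLiu418 = stmt-HodgeConjecture-24832, h413 =
stmt-HodgeConjecture-24833) until rung 0 closes; this file discharges none of them (cell `hodgecm-mathlib`, squad TL, TL-t14 g2).

## References
* [Liu2021] Y. Liu, *Fourier–Jacobi cycles and arithmetic relative trace formula (with an appendix by C. Li and Y. Zhu)*,
  Camb. J. Math. **9** (2021) 1–147: Thm. A.7 and its proof (p. 95 L28–30); Prop. A.2 (p. 92), Lem. A.4 (p. 94), Lem. A.6 (p. 95);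
  item 1.12 and Rem. 1.14 (pp. 14–15).
* Named in the print's proof of Lem. A.6 (not used here): [RTZ13] Rapoport–Terstiege–Zhang, Prop. 8.1; [HLZ19] He–Li–Zhu,
  Lem. 5.1.1 & Thm. 4.6.3; [LZ17] Li–Zhu, Cor. 3.2.3.
* Tree (★): `Liu2021.AppendixA.AFLMinusculeCase` (`AFLData`, `PropA2`, `LemA4`, `LemA6`, `NotationAsAbove`, `omega`, `altSumN`,
  `oddSelfRecFactors`, `lzCount`), `Liu2021.Sec13to16IntroductionAFL` (`Sec13Data.Rem114`, `transferFactor`, `chiInt`).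
-/

noncomputable section

open Polynomial

namespace Literature.NumberTheory.Automorphic.Liu2021.AppendixA.AFLMinusculeCase

namespace AFLCarriers

universe u

variable {F E : Type u} [Field F] [Field E] [Algebra F E] {κ : Type u} [Field κ]

/-- App. A's transfer factor `ω(ζ, y) = (−1)^{v(ζ,y)}` squares to `1` (it is a unit `±1` of `ℤ`).
[cite: Liu2021, App. A §A.1 (p. 90 L20–21)] -/
theorem omega_mul_omega (D : AFLCarriers F E κ) (ζ : Matrix (Fin D.n) (Fin D.n) E) (y : D.Mn) :
    D.omega ζ y * D.omega ζ y = 1 := by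
  unfold omega
  rw [← Units.val_mul, Int.units_mul_self, Units.val_one]

end AFLCarriers

namespace AFLData

universe u

variable {F E : Type u} [Field F] [Field E] [Algebra F E] {κ : Type u} [Field κ] [DecidableEq κ]

/-- **Theorem A.7, assembled as printed** («Conjecture 1.12 holds when `(ξ, x)` is minuscule» — «This follows immediately from
Proposition A.2, Lemma A.4, and Lemma A.6», p. 95 L28–30): for a datum `D : AFLData F E κ`, the carpet's ★ `PropA2`, ★ `LemA4`,
★ `LemA6` (with the datum's field `transferFactor_eq` identifying §1.3's `ω = μ_{E/F}(det …)` with App. A's `(−1)^v`) imply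
★ `Sec13Data.Rem114` (= 1.12 in the minuscule case), GIVEN the two standing properties of the carriers that the printed
«immediately» uses silently: `hχ0` (empty `𝒱(Λ)^{ξ̄}` ⇒ `χ = 0`) and `hne` (a unique odd self-reciprocal factor `Q(T)` ⇒
`𝒱(Λ)^{ξ̄}` non-empty; the converse half of Lem. A.6's first sentence, [RTZ13, Prop. 8.1]).  Computation: `−ω · d/ds|₀ Orb =
−ω · (−2 log q · ω · Σ) = 2 log q · ω² · Σ = 2 log q · Σ` (A.2, `ω² = 1`), and `Σ = χ`: if `Q(T)` exists, `Σ = lzCount Q` (A.4) `=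
length_k 𝒱(Λ)^{ξ̄} = χ` (A.6 with `hne`); otherwise `Σ = 0` (A.4) and `𝒱(Λ)^{ξ̄} = ∅` (A.6), so `χ = 0` (`hχ0`).
[cite: Liu2021, Thm. A.7 (p. 95 L28–30)] -/
theorem rem114_of_propA2_lemA4_lemA6 (D : AFLData F E κ) (h2 : D.PropA2) (h4 : D.LemA4) (h6 : D.LemA6)
    (hχ0 : ∀ (ξ : D.U false) (x : D.V false), D.IsEmptyK (D.dlFixed ξ x) → D.chiInt ξ x = 0)
    (hne : ∀ (ζ : Matrix (Fin D.n) (Fin D.n) E) (y : D.Mn) (ξ : D.U false) (x : D.V false),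
      D.NotationAsAbove ζ y ξ x → D.IsMinuscule ξ x →
      (∃ Q : κ[X], oddSelfRecFactors D.conjκ (D.redCharpoly ξ x) = {Q}) → ¬ D.IsEmptyK (D.dlFixed ξ x)) :
    D.Rem114 := by
  intro ζ y ξ x hSn hRS hMinus hRSU hMatch hMin
  have hN : D.NotationAsAbove ζ y ξ x := ⟨hSn, hRS, hMinus, hRSU, hMatch⟩
  -- Σ = χ (Lem. A.4 + Lem. A.6 + the two silent steps)
  have hsum : D.altSumN ξ x (D.deltaVal ζ y) = D.chiInt ξ x := by
    obtain ⟨h4Q, h4none⟩ := h4 ζ y ξ x hN hMin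
    obtain ⟨h6none, h6ne⟩ := h6 ζ y ξ x hN hMin
    by_cases hQ : ∃ Q : κ[X], oddSelfRecFactors D.conjκ (D.redCharpoly ξ x) = {Q}
    · obtain ⟨Q, hQ'⟩ := hQ
      obtain ⟨-, hχ, hlen⟩ := h6ne (hne ζ y ξ x hN hMin ⟨Q, hQ'⟩)
      rw [h4Q Q hQ', hχ, hlen Q hQ']
    · rw [h4none hQ, hχ0 ξ x (h6none hQ)]
  -- −ω · (−2 log q · ω · Σ) = 2 log q · Σ
  have hω : (D.omega ζ y : ℂ) * (D.omega ζ y : ℂ) = 1 := by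
    exact_mod_cast D.toAFLCarriers.omega_mul_omega ζ y
  rw [D.transferFactor_eq ζ y hSn hRS, h2 ζ y ξ x hN, hsum]
  linear_combination (2 * (Real.log D.q : ℂ) * (D.chiInt ξ x : ℂ)) * hω

end AFLData

end Literature.NumberTheory.Automorphic.Liu2021.AppendixA.AFLMinusculeCase

end
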